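import Summits.CriticalPhenomena.Ising3DConformalLimit.Theses.MarkovRigidity
import Literature.Probability.LatticeModels.CriticalScalingDimension

/-!
# CriticalPhenomena / Ising3DConformalLimit — route MarkovRigidity, assembly

Settles item `stmt-CriticalPhenomena-7564` (rank 1, assembly of route
`route-CriticalPhenomena-MarkovRigidity`):

`MarkovInheritance → NelsonPolyakovRigidity → ExistsScaleCovariantLimit → FieldRealisation →
CubicSymmetryOfLimit → CubicClosure → IsingEuclidUpgradeR4NonGaussian → Ising3DConformalLimit`.

Pure logic over the summit's structure predicates plus ONE proved Literature theorem,
`Literature.Probability.LatticeModels.scalingDimension_mem_Icc_holds` (`1/2 ≤ Δ ≤ 1` for every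
scale-covariant non-degenerate pointwise scaling limit of `criticalCorr 3`; Simon 1980 / Lieb 1980
lower bound and the Fröhlich–Simon–Spencer infrared bound, Duminil-Copin 2019 Thm. 4.8): take
`ρ, Δ, S` from (E₀) `ExistsScaleCovariantLimit`; `FieldRealisation` gives continuity of `S` on
`NonCoincident` and a law `μ` on `𝒮'(ℝ³)` with all moments, exponential moments, moment densities
`S`, translation-invariant and scale-covariant law, time-reflection invariance, OS reflection
positivity and time clustering; `MarkovInheritance` makes `μ` germ-Markov for balls and
half-spaces; `scalingDimension_mem_Icc_holds` gives `1/2 ≤ Δ ≤ 1`; `NelsonPolyakovRigidity` gives a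
continuous linear automorphism `A` with `S ∘ A` Möbius covariant of weight `Δ`;
`CubicSymmetryOfLimit` gives hyperoctahedral invariance of `S` and `CubicClosure` upgrades to
`IsMoebiusCovariant Δ S`; `IsingEuclidUpgradeR4NonGaussian` gives `HasNontrivialU4 S`; conclude
`CritIsing3DConformalLimit` (= `Ising3DConformalLimit`). The theorem is unconditional bookkeeping.
-/

namespace Summit.CriticalPhenomena.Ising3DConformalLimit.Theorems

open Summit.CriticalPhenomena.Ising3DConformalLimit.Theses.MarkovRigidity
open Literature.Probability.LatticeModels

/-- Settles `stmt-CriticalPhenomena-7564` (exact signature): the assembly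
`MarkovInheritance → NelsonPolyakovRigidity → ExistsScaleCovariantLimit → FieldRealisation →
CubicSymmetryOfLimit → CubicClosure → IsingEuclidUpgradeR4NonGaussian → Ising3DConformalLimit`
of route MarkovRigidity. Proof: `ρ, Δ, S` from `ExistsScaleCovariantLimit`; `FieldRealisation` ⇒
continuity on `NonCoincident` and the law `μ`; `MarkovInheritance` ⇒ germ-Markov;
`scalingDimension_mem_Icc_holds` ⇒ `1/2 ≤ Δ ≤ 1`; `NelsonPolyakovRigidity` ⇒ `A` with `S ∘ A`
Möbius; `CubicSymmetryOfLimit` + `CubicClosure` ⇒ `IsMoebiusCovariant Δ S`;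
`IsingEuclidUpgradeR4NonGaussian` ⇒ `U₄ ≢ 0`. [folklore] -/
theorem markovRigidity_assembly_proof :
    Summit.CriticalPhenomena.Ising3DConformalLimit.Theses.MarkovRigidity.Assembly := by
  unfold Assembly
  intro hMI hNPR hE hFR hCS hCC hNG
  obtain ⟨ρ, Δ, S, hρ, hΔ, hlim, hnorm, hnd, htr, hsc⟩ := hE
  obtain ⟨hcont, μ, hprob, hmom, hexp, hdens, htrl, hscl, hθ, hRP, hclust⟩ :=
    hFR ρ Δ S hρ hlim hnorm hnd htr hsc
  have hIcc : Δ ∈ Set.Icc (1 / 2 : ℝ) 1 :=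
    scalingDimension_mem_Icc_holds ρ Δ S hlim hsc hnd hρ
  have hMarkov := hMI ρ Δ S μ hρ hlim hnorm hnd htr hsc hprob hmom hexp hdens
  obtain ⟨A, hA⟩ :=
    hNPR μ Δ S hprob hmom hexp htrl hscl hθ hRP hclust hMarkov hIcc.1 hIcc.2 hdens hnorm hcont hnd
  have hcubic := hCS ρ Δ S hρ hlim hnorm hnd htr hsc
  have hMoeb : IsMoebiusCovariant Δ S := hCC Δ S A hΔ hnd hcubic hA
  have hU4 : HasNontrivialU4 S := hNG ρ S hρ hlim hnd
  exact ⟨ρ, Δ, S, hρ, hΔ, hlim, hnd, hMoeb, hU4⟩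

end Summit.CriticalPhenomena.Ising3DConformalLimit.Theorems
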